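import Summits.Langlands.Langlands.Theorems.IrreducibilityBySelfDualityReciprocityUpToIrreducibilityCorrespondsConj
import HarnessLib

/-!
# Stub `stub_avatarConjugate` for line `PhantomRMJunctionOfPieces` (crux stmt-Langlands-13643, `PhantomRMJunction`)

Piece A′ (`AutomorphicToGaloisOfDatum`, direction (A) for some pinned reciprocity datum) of the
BC2-redirect decomposition `N → U → A′ → B′ → PhantomRMJunction` asks, besides the two open cores
(weak existence of an irreducible geometric avatar, local–global compatibility everywhere), for the
UNIQUENESS clause of `Summit.Langlands.AutomorphicToGalois`: two representations corresponding to
the same cuspidal `π`, one of them irreducible, are `GL_n(ℚ̄_ℓ)`-conjugate.  This is a theorem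
(Deligne–Serre 1974, Lemme 3.2: uniqueness of Satake parameters, Chebotarev density, transfer of
irreducibility along equal traces, Brauer–Nesbitt in characteristic `0`, equivalent framed
representations are conjugate), and it is ALREADY in the tree as
`Theorems.ReciprocityUpToIrreducibility.isConjugate_of_satakeFrobCompatibleAt` (crux
stmt-Langlands-14328, line `Sketch`, lead c2): the registered stub is its corollary, since
`Corresponds` contains almost-everywhere Satake–Frobenius compatibility as its first conjunct.
-/

set_option linter.dupNamespace false -- `Summit.Langlands.Langlands` is the mandated namespace

noncomputable section

open scoped MatrixGroups NumberField
open Literature.NumberTheory.Automorphic Literature.NumberTheory.GaloisRepresentations Summit.Langlands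

namespace Summit.Langlands.Langlands.Theorems.PhantomRMJunctionOfPieces

/-- **Registered stub `stub_avatarConjugate` (verbatim): conjugacy of avatars.**  If `ρ` is
irreducible and both `ρ` and `ρ'` correspond (via `ι`, for the reciprocity datum `Rec`) to the
cuspidal `π`, then `ρ'` is conjugate to `ρ` — by
`ReciprocityUpToIrreducibility.isConjugate_of_satakeFrobCompatibleAt` applied to the Satake
conjuncts of the two `Corresponds` hypotheses. [cite: DeligneSerreASENS1974, Lemme 3.2] -/
theorem stub_avatarConjugate :
    ∀ (K : Type) [Field K] [NumberField K] (Rec : Summit.Langlands.ReciprocityData K) (n : ℕ) (hcpt : Literature.NumberTheory.Automorphic.isCompact_glFiniteIntegralLevel n K) (ℓ : ℕ) [Fact ℓ.Prime] (ι : PadicAlgCl ℓ ≃+* ℂ) (π : Literature.NumberTheory.Automorphic.CuspidalAutomorphicRepData n K hcpt) (ρ ρ' : Literature.NumberTheory.GaloisRepresentations.FramedGaloisRep K (PadicAlgCl ℓ) n), ρ.toGaloisRep.IsIrreducible → Summit.Langlands.Corresponds Rec ι π.1 ρ → Summit.Langlands.Corresponds Rec ι π.1 ρ' → Summit.Langlands.IsConjugate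 ρ ρ' :=
  fun _K _ _ _Rec _n _hcpt _ℓ _ ι π _ρ _ρ' hirr h h' ↦
    ReciprocityUpToIrreducibility.isConjugate_of_satakeFrobCompatibleAt π.1 ι hirr h.1 h'.1

end Summit.Langlands.Langlands.Theorems.PhantomRMJunctionOfPieces

end
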